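import Mathlib

/-!
# Route `FilamentSkeletonRss` · cruxes `SkeletonJ1L` (stmt-NavierStokesRegularity-23296, registered stub `stub_tangentSkeletonL` ≡
# `TangentSkeletonNearStraightL`, stmt-23320) · line `child_tangent_analytic_strip_L` (b0b56c52900dd90a), stub `stub_stripPropagation` —
# brick for `rcore`: GLUING A FOOT FROM ITS COMPACT PART AND ITS TAIL

The frozen feet of the quarter-width tent are half-line integrals `∫_{Ioi r₀} g_z`, `∫_{Iic ℓ₀} g_z` of the real-source kernel.  Near the anchor
they are certified in two pieces: a COMPACT part (`Theorems.StadiumFrozenRealPiece.frozenRealPiece_nhds` on `[r₀, r₀ + c]`, positivity at the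
anchor) and a TAIL (`Theorems.StadiumQuarterFootTail(.Left).quarter_foot_tail(_left)` beyond `r₀ + c`, Lorentzian majorant), each holomorphic in
the target on a neighbourhood and integrable.  This file is the measure-theoretic glue, for any integrand `g : ℂ → ℝ → E`:
* `halfline_right_glue` — on a target set `V` where `g_z` is integrable on `Icc a b` and on `Ioi b` and both pieces are holomorphic,
  `∫_{Ioi a} g_z = ∫_{Icc a b} g_z + ∫_{Ioi b} g_z`, `g_z` is integrable on `Ioi a`, and `z ↦ ∫_{Ioi a} g_z` is holomorphic on `V`;
* `halfline_left_glue` — the same for `Iic b = Iic a ∪ Icc a b`.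
These produce exactly the `hfeet` / `hint` hypotheses of `Theorems.StadiumTentFreezeNhds.tent_eq_frozen_nhds_sharp`.
HONEST FRAMING: bookkeeping for a HYPOTHETICAL filament skeleton on the NEGATIVE side of a MODEL route; the stub `stub_stripPropagation` is NOT closed
by this file, `TangentSkeletonNearStraightL` / `SkeletonJ1L` stay OPEN; nothing here bears on Navier–Stokes regularity or blow-up.
`--supports stmt-NavierStokesRegularity-23320` (≡ stub `stub_tangentSkeletonL` of 23296).
-/

set_option linter.dupNamespace false

noncomputable section

namespace Summit.NavierStokesRegularity.NavierStokesRegularity.Theorems.StadiumHalfLineGlue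

open Set MeasureTheory

variable {E : Type*} [NormedAddCommGroup E] [NormedSpace ℝ E] [NormedSpace ℂ E]

/-- **Right foot = compact part + tail.**  For `a ≤ b` and an integrand `g : ℂ → ℝ → E` which, for every target `z ∈ V`, is integrable on
`Icc a b` and on `Ioi b`: `g z` is integrable on `Ioi a`, `∫_{Ioi a} g z = ∫_{Icc a b} g z + ∫_{Ioi b} g z`, and if both pieces are holomorphic
on `V` then so is `z ↦ ∫_{Ioi a} g z`. [folklore] -/
theorem halfline_right_glue {g : ℂ → ℝ → E} {V : Set ℂ} {a b : ℝ} (hab : a ≤ b)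
    (hint : ∀ z ∈ V, IntegrableOn (g z) (Icc a b) ∧ IntegrableOn (g z) (Ioi b))
    (hdiff₁ : DifferentiableOn ℂ (fun z => ∫ σ in Icc a b, g z σ) V)
    (hdiff₂ : DifferentiableOn ℂ (fun z => ∫ σ in Ioi b, g z σ) V) :
    (∀ z ∈ V, IntegrableOn (g z) (Ioi a) ∧
      (∫ σ in Ioi a, g z σ) = (∫ σ in Icc a b, g z σ) + ∫ σ in Ioi b, g z σ) ∧
    DifferentiableOn ℂ (fun z => ∫ σ in Ioi a, g z σ) V := by
  have hsplit : ∀ z ∈ V, IntegrableOn (g z) (Ioi a) ∧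
      (∫ σ in Ioi a, g z σ) = (∫ σ in Icc a b, g z σ) + ∫ σ in Ioi b, g z σ := by
    intro z hz
    obtain ⟨h1, h2⟩ := hint z hz
    have h1' : IntegrableOn (g z) (Ioc a b) := h1.mono_set Ioc_subset_Icc_self
    have hunion : Ioc a b ∪ Ioi b = Ioi a := Ioc_union_Ioi_eq_Ioi hab
    have hdisj : Disjoint (Ioc a b) (Ioi b) := by
      rw [Set.disjoint_left]
      intro x hx hx'
      exact absurd hx.2 (not_le.mpr hx')
    refine ⟨?_, ?_⟩
    · rw [← hunion]; exact h1'.union h2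
    · rw [← hunion, setIntegral_union hdisj measurableSet_Ioi h1' h2, integral_Icc_eq_integral_Ioc]
  refine ⟨hsplit, ?_⟩
  refine (hdiff₁.add hdiff₂).congr fun z hz => ?_
  exact (hsplit z hz).2

/-- **Left foot = tail + compact part.**  For `a ≤ b`: integrability on `Iio a` and `Icc a b` gives integrability on `Iic b`,
`∫_{Iic b} g z = ∫_{Iio a} g z + ∫_{Icc a b} g z`, and holomorphy of both pieces gives holomorphy of `z ↦ ∫_{Iic b} g z`. [folklore] -/
theorem halfline_left_glue {g : ℂ → ℝ → E} {V : Set ℂ} {a b : ℝ} (hab : a ≤ b)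
    (hint : ∀ z ∈ V, IntegrableOn (g z) (Iio a) ∧ IntegrableOn (g z) (Icc a b))
    (hdiff₁ : DifferentiableOn ℂ (fun z => ∫ σ in Iio a, g z σ) V)
    (hdiff₂ : DifferentiableOn ℂ (fun z => ∫ σ in Icc a b, g z σ) V) :
    (∀ z ∈ V, IntegrableOn (g z) (Iic b) ∧
      (∫ σ in Iic b, g z σ) = (∫ σ in Iio a, g z σ) + ∫ σ in Icc a b, g z σ) ∧
    DifferentiableOn ℂ (fun z => ∫ σ in Iic b, g z σ) V := by
  have hsplit : ∀ z ∈ V, IntegrableOn (g z) (Iic b) ∧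
      (∫ σ in Iic b, g z σ) = (∫ σ in Iio a, g z σ) + ∫ σ in Icc a b, g z σ := by
    intro z hz
    obtain ⟨h1, h2⟩ := hint z hz
    have hunion : Iio a ∪ Icc a b = Iic b := Iio_union_Icc_eq_Iic hab
    have hdisj : Disjoint (Iio a) (Icc a b) := by
      rw [Set.disjoint_left]
      intro x hx hx'
      exact absurd hx'.1 (not_le.mpr hx)
    refine ⟨?_, ?_⟩
    · rw [← hunion]; exact h1.union h2
    · rw [← hunion, setIntegral_union hdisj measurableSet_Icc h1 h2]
  refine ⟨hsplit, ?_⟩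
  refine (hdiff₁.add hdiff₂).congr fun z hz => ?_
  exact (hsplit z hz).2

omit [NormedSpace ℂ E] in
/-- The tails over `Iio a` and `Iic a` agree (a point is null), for the convenience of users of `Theorems.StadiumQuarterFootTailLeft`
(stated on `Iic`). [folklore] -/
theorem integral_Iio_eq_Iic {g : ℝ → E} (a : ℝ) : (∫ σ in Iio a, g σ) = ∫ σ in Iic a, g σ :=
  (integral_Iic_eq_integral_Iio).symm

end Summit.NavierStokesRegularity.NavierStokesRegularity.Theorems.StadiumHalfLineGlue

end
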